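import Summits.QuantumAdvantage.QuantumAdvantage.Theorems.RingLeaderElection3B
import Summits.QuantumAdvantage.QuantumAdvantage.Theorems.RingDeck

/-!
# Symmetrisation of ring strategies on the odd class over `𝔽₃`

Cell decomp-qadv, seat lens-2 («structural dichotomy: special vs generic»), generation 12 — LAND-READY tree
twin of the node `HOME/decomp-qadv-lens-2/g12/LeaderDial.lean` (node sha256 ef4b277d…; farm rc 0 · 0 sorries ·
axioms {propext, Classical.choice, Quot.sound}).  Explicit binders, no new `Prop` items; `decide` is used only on
closed `ZMod 3` literals.

SYMMETRISATION ON THE ODD CLASS OVER `𝔽₃`: given a `{0,1}`-valued election polynomial `e` (degree `De`) and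
ANY strategy `P : Fin n → CubeFn (ZMod 3) n` of degree `D`, the single polynomial
`symPoly e P = Σ_s e(rot_s ·)·P_{−s}(rot_s ·)` (degree `≤ D + De`) is such that its COVARIANT rule
`x ↦ (b ↦ [symPoly(rot_b x) = 1])` agrees with `P`'s rule, up to the rotation by the leader, on every input
with exactly one firing rotation (`rel_cov_symPoly_iff`, via `RingHLF.rel_rot`); since `OddZeros` is
rotation-invariant (`Summit.QuantumAdvantage.QuantumAdvantage.Theorems.RingMinor.oddZeros_rot`) and rotation is a bijection, the odd-class win count of `P` is at most that
of the covariant rule plus the bad set (`symmetrization3`: `#S ≤ W + #Bad`).  Tree precedent for all patterns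
over `𝔽₂`: `Symmetrization.symmetrization`.
-/

set_option linter.dupNamespace false

noncomputable section

open scoped Classical

namespace Summit.QuantumAdvantage.QuantumAdvantage.Theorems

open Finset
open Literature.Computability.QuantumComplexity Literature.Computability.QuantumComplexity.RingHLF
open Literature.Computability.MetaComplexity Literature.Computability.MetaComplexity.Smolensky
open Summit.QuantumAdvantage.AdviceFreeQNC0
open Summit.QuantumAdvantage.AdviceFreeQNC0.RingSymmetry
open Summit.QuantumAdvantage.AdviceFreeQNC0.LeaderElection
open Summit.QuantumAdvantage.QuantumAdvantage.Theorems.RingPeriodFold (cov covStrat covLosing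
  mem_covLosing covStrat_mem_lowDeg cov_eq_covStrat ind_rot_mem')

namespace RingSymmetrization3

open RingLeaderElection3
open Summit.QuantumAdvantage.AdviceFreeQNC0.Symmetrization (off off_add_mod fire_index_iff pre
  shift_pre pre_shift)

variable {n : ℕ}

/-- the LEADER of `x` under the election polynomial `e`: a rotation at which `e` fires (junk `⟨0,_⟩`
if none). -/
def leader (hn : 0 < n) (e : CubeFn (ZMod 3) n) (x : Fin n → Bool) : Fin n :=
  if h : ∃ b : Fin n, e (rot b.val x) = 1 then Classical.choose h else ⟨0, hn⟩

/-- If `e` fires at exactly one rotation of `x`, it fires exactly at the leader. -/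
theorem fires_iff_eq_leader (hn : 0 < n) {e : CubeFn (ZMod 3) n} {x : Fin n → Bool}
    (hx : fireCount3 e x = 1) (b : Fin n) : e (rot b.val x) = 1 ↔ b = leader hn e x := by
  unfold fireCount3 at hx
  obtain ⟨a, ha⟩ := card_eq_one.1 hx
  have hmem : ∀ b : Fin n, e (rot b.val x) = 1 ↔ b = a := by
    intro b'
    have := Finset.ext_iff.1 ha b'
    rw [mem_filter, mem_singleton] at this
    simpa using this
  have hex : ∃ b : Fin n, e (rot b.val x) = 1 := ⟨a, (hmem a).2 rfl⟩
  have hlead : leader hn e x = a := by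
    unfold leader
    rw [dif_pos hex]
    exact (hmem _).1 (Classical.choose_spec hex)
  rw [hlead]
  exact hmem b

/-- **the symmetrized polynomial** of the tuple `P` with origin shift `s`, relative to the election
polynomial `e`: `y ↦ Σ_i P_i(rot_{off i + s} y) · e(rot_{off i} y)`. -/
def symPoly (e : CubeFn (ZMod 3) n) (P : Fin n → CubeFn (ZMod 3) n) (s : ℕ) : CubeFn (ZMod 3) n :=
  fun y => ∑ i : Fin n, P i (rot (off n i.val s + s) y) * e (rot (off n i.val s) y)

/-- Degree of the symmetrized polynomial: `deg P + deg e`. -/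
theorem symPoly_mem {D De : ℕ} {e : CubeFn (ZMod 3) n} (he : e ∈ lowDeg (ZMod 3) n De)
    {P : Fin n → CubeFn (ZMod 3) n} (hP : ∀ i, P i ∈ lowDeg (ZMod 3) n D) (s : ℕ) :
    symPoly e P s ∈ lowDeg (ZMod 3) n (D + De) := by
  have e1 : symPoly e P s = ∑ i : Fin n,
      ((fun y => P i (rot (off n i.val s + s) y)) * fun y => e (rot (off n i.val s) y)) := by
    funext y
    unfold symPoly
    rw [Finset.sum_apply]
    rfl
  rw [e1]
  refine Submodule.sum_mem _ fun i _ => mul_mem_lowDeg_add ?_ ?_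
  · exact Smolensky.comp_mem_lowDeg_of_coord (rot (off n i.val s + s)) (ind_rot_mem' _) (hP i)
  · exact Smolensky.comp_mem_lowDeg_of_coord (rot (off n i.val s)) (ind_rot_mem' _) he

/-- **Evaluation of the symmetrized polynomial** at a rotation of a pattern with a unique leader
`b₀` (for a `{0,1}`-valued `e`): only the term `i = pre b₀ s b` fires, and it reads `P_i` at
`rot (b₀ + s) x`. -/
theorem symPoly_rot (hn : 0 < n) {e : CubeFn (ZMod 3) n} (he01 : ∀ y, e y = 0 ∨ e y = 1)
    {x : Fin n → Bool} (hx : fireCount3 e x = 1) (P : Fin n → CubeFn (ZMod 3) n) (s : ℕ) (b : Fin n) :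
    symPoly e P s (rot b.val x) =
      P (pre (leader hn e x) s b) (rot (((leader hn e x).val) + s) x) := by
  set b₀ := leader hn e x with hb₀
  unfold symPoly
  simp only [rot_rot]
  have hfire : ∀ i : Fin n, e (rot (off n i.val s + b.val) x) = 1 ↔ i = pre b₀ s b := by
    intro i
    rw [← rot_mod, fires_iff_eq_leader hn hx ⟨(off n i.val s + b.val) % n, Nat.mod_lt _ hn⟩,
      ← hb₀]
    constructor
    · intro h
      have hv : (off n i.val s + b.val) % n = b₀.val := congrArg Fin.val h
      have := (fire_index_iff hn b₀ b i s).1 hv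
      rw [← this, pre_shift]
    · intro h
      apply Fin.ext
      simp only
      rw [fire_index_iff hn b₀ b i s, h, shift_pre]
  rw [Finset.sum_eq_single (pre b₀ s b)]
  · have h1 : e (rot (off n (pre b₀ s b).val s + b.val) x) = 1 := (hfire _).2 rfl
    rw [h1, mul_one]
    congr 1
    apply rot_eq_rot_of_mod_eq
    have h2 : (off n (pre b₀ s b).val s + b.val) % n = b₀.val :=
      (fire_index_iff hn b₀ b _ s).2 (shift_pre b₀ s b)
    have h3 : (off n (pre b₀ s b).val s + b.val + s) % n = (b₀.val + s) % n :=
      Nat.ModEq.add_right _ (show (off n (pre b₀ s b).val s + b.val) % n = b₀.val % n by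
        rw [h2, Nat.mod_eq_of_lt b₀.isLt])
    rw [← h3]
    congr 1
    ring
  · intro i _ hi
    have h0 : e (rot (off n i.val s + b.val) x) = 0 := by
      rcases he01 (rot (off n i.val s + b.val) x) with h | h
      · exact h
      · exact absurd ((hfire i).1 h) hi
    rw [h0, mul_zero]
  · intro h; exact absurd (mem_univ _) h

/-- **The symmetrized rule in leader-relative coordinates**: for a pattern with a unique leader, the
covariant rule of `symPoly e P s` solves `x` iff `P` solves `rot (b₀ + s) x`. -/
theorem rel_cov_symPoly_iff (hn : 0 < n) {e : CubeFn (ZMod 3) n} (he01 : ∀ y, e y = 0 ∨ e y = 1)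
    {x : Fin n → Bool} (hx : fireCount3 e x = 1) (P : Fin n → CubeFn (ZMod 3) n) (s : ℕ) :
    RingHLF.Rel x (cov (symPoly e P s) x) ↔
      RingHLF.Rel (rot ((leader hn e x).val + s) x)
        (fun i => decide (P i (rot ((leader hn e x).val + s) x) = 1)) := by
  set k := (leader hn e x).val + s with hk
  rw [← rel_rot k x]
  have e1 : rot k (cov (symPoly e P s) x) = fun i => decide (P i (rot k x) = 1) := by
    funext i
    rw [rot_apply]
    unfold cov
    rw [symPoly_rot hn he01 hx P s, hk, pre_shift]
  rw [e1]

/-- **Odd-class symmetrisation, core count**: if every covariant rule of degree `≤ D + De` wins at most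
`W` odd patterns, and `e` (degree `De`, `{0,1}`-valued) elects a unique leader off a set `Bad`, then every
degree-`D` strategy wins at most `W + #Bad` odd patterns (average over the `n` origin shifts). -/
theorem symmetrization3 (hn : 0 < n) {D De : ℕ} {e : CubeFn (ZMod 3) n}
    (he : e ∈ lowDeg (ZMod 3) n De) (he01 : ∀ y, e y = 0 ∨ e y = 1) (W : ℝ)
    (hE : ∀ Q : CubeFn (ZMod 3) n, Q ∈ lowDeg (ZMod 3) n (D + De) →
      ((univ.filter fun x : Fin n → Bool => OddZeros x ∧ RingHLF.Rel x (cov Q x)).card : ℝ) ≤ W)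
    (P : Fin n → CubeFn (ZMod 3) n) (hP : ∀ i, P i ∈ lowDeg (ZMod 3) n D) :
    ((univ.filter fun x : Fin n → Bool =>
        OddZeros x ∧ RingHLF.Rel x (fun i => decide (P i x = 1))).card : ℝ) ≤
      W + (univ.filter fun x : Fin n → Bool => fireCount3 e x ≠ 1).card := by
  set S := univ.filter fun x : Fin n → Bool =>
    OddZeros x ∧ RingHLF.Rel x (fun i => decide (P i x = 1)) with hS
  set G := univ.filter fun x : Fin n → Bool => fireCount3 e x = 1 with hG
  set Bad := univ.filter fun x : Fin n → Bool => fireCount3 e x ≠ 1 with hBad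
  have hZ : ∀ s : Fin n,
      ((univ.filter fun x : Fin n → Bool =>
          OddZeros x ∧ RingHLF.Rel x (cov (symPoly e P s.val) x)).card : ℝ) ≤ W :=
    fun s => hE _ (symPoly_mem he hP s.val)
  have hGZ : ∀ s : Fin n,
      (G.filter fun x => rot ((leader hn e x).val + s.val) x ∈ S) ⊆
        univ.filter fun x : Fin n → Bool =>
          OddZeros x ∧ RingHLF.Rel x (cov (symPoly e P s.val) x) := by
    intro s x hx
    rw [mem_filter, hG, mem_filter] at hx
    rw [mem_filter]
    have := hx.2
    rw [hS, mem_filter] at this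
    refine ⟨mem_univ _, (Summit.QuantumAdvantage.QuantumAdvantage.Theorems.RingMinor.oddZeros_rot _ x).1 this.2.1, ?_⟩
    rw [rel_cov_symPoly_iff hn he01 hx.1.2 P s.val]
    exact this.2.2
  have hswap : ∑ s : Fin n, (G.filter fun x => rot ((leader hn e x).val + s.val) x ∈ S).card =
      ∑ s' : Fin n, (G.filter fun x => rot s'.val x ∈ S).card := by
    simp only [card_filter]
    rw [Finset.sum_comm]
    conv_rhs => rw [Finset.sum_comm]
    refine sum_congr rfl fun x _ => ?_
    simp only [← card_filter]
    have e2 : (univ.filter fun s : Fin n => rot ((leader hn e x).val + s.val) x ∈ S) =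
        univ.filter fun s : Fin n => rot (shift n (leader hn e x).val s).val x ∈ S := by
      refine filter_congr fun s _ => ?_
      rw [show (leader hn e x).val + s.val = s.val + (leader hn e x).val by ring]
      simp only [shift, rot_mod]
    rw [e2]
    exact card_filter_shift (leader hn e x).val (fun s' : Fin n => rot s'.val x ∈ S)
  have hsplit : ∀ s' : Fin n, S.card ≤ (G.filter fun x => rot s'.val x ∈ S).card + Bad.card := by
    intro s'
    have hS' : (univ.filter fun x : Fin n → Bool => rot s'.val x ∈ S).card = S.card := by
      rw [card_filter_rot s'.val (fun y : Fin n → Bool => y ∈ S), filter_mem_eq_inter, univ_inter]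
    rw [← hS']
    calc (univ.filter fun x : Fin n → Bool => rot s'.val x ∈ S).card
        ≤ ((G.filter fun x => rot s'.val x ∈ S) ∪ Bad).card := by
          refine card_le_card fun x hx => ?_
          rw [mem_filter] at hx
          rw [mem_union]
          by_cases h : fireCount3 e x = 1
          · exact Or.inl (mem_filter.2 ⟨by rw [hG]; exact mem_filter.2 ⟨mem_univ _, h⟩, hx.2⟩)
          · exact Or.inr (by rw [hBad]; exact mem_filter.2 ⟨mem_univ _, h⟩)
      _ ≤ _ := card_union_le _ _
  have hsum : (n : ℝ) * S.card ≤ n * W + n * Bad.card := by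
    have h1 : n * S.card ≤ ∑ s' : Fin n, ((G.filter fun x => rot s'.val x ∈ S).card + Bad.card) := by
      calc n * S.card = ∑ _s' : Fin n, S.card := by
            rw [sum_const, card_univ, Fintype.card_fin, smul_eq_mul]
        _ ≤ _ := sum_le_sum fun s' _ => hsplit s'
    rw [sum_add_distrib, sum_const, card_univ, Fintype.card_fin, smul_eq_mul, ← hswap] at h1
    have h2 : ∑ s : Fin n, ((G.filter fun x => rot ((leader hn e x).val + s.val) x ∈ S).card : ℝ)
        ≤ n * W := by
      calc ∑ s : Fin n, ((G.filter fun x => rot ((leader hn e x).val + s.val) x ∈ S).card : ℝ)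
          ≤ ∑ _s : Fin n, W :=
            sum_le_sum fun s _ => le_trans (by exact_mod_cast card_le_card (hGZ s)) (hZ s)
        _ = n * W := by rw [sum_const, card_univ, Fintype.card_fin, nsmul_eq_mul]
    have h1R : ((n * S.card : ℕ) : ℝ) ≤
        ((∑ s : Fin n, (G.filter fun x => rot ((leader hn e x).val + s.val) x ∈ S).card : ℕ) : ℝ) +
          ((n * Bad.card : ℕ) : ℝ) := by exact_mod_cast h1
    push_cast at h1R
    linarith
  have hnR : (0 : ℝ) < n := by exact_mod_cast hn
  nlinarith


end RingSymmetrization3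

end Summit.QuantumAdvantage.QuantumAdvantage.Theorems
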